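import Literature.Probability.RandomPlanarGeometry.BrownianLoopMeasure
import Literature.Probability.RandomPlanarGeometry.UnbasedLoopImage
import HarnessLib

/-!
# Conformal invariance of `Λ(K₁, K₂; D)` from conformal invariance of `μ^loop_D`

Lawler, *Partition functions, loop measure, and versions of SLE*, J. Stat. Phys. **134** (2009)
(**[Lawler2009]**), §2.2, lists two properties of the Brownian loop measure — restriction, and
"**Conformal invariance.** If `f : D → f(D)` is a conformal transformation, then the image of
the loop measure on `D` under `f` is the same as the loop measure in `f(D)`" (Lawler–Werner,
*The Brownian loop soup*, PTRF **128** (2004) (**[LW04]**), §4.1, Prop. 6: "`f ∘ μ^loop_D =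
μ^loop_{D'}`") — and deduces, for the mass `Λ(K₁, K₂; D)` of the loops in `D` meeting both `K₁`
and `K₂`: "if `f : D → f(D)` is a conformal transformation, then
`Λ(f(K₁), f(K₂); f(D)) = Λ(K₁, K₂; D)`" (the named fact `loopMass_conformalImage` of
`BrownianLoopMeasure`).

This file proves that deduction for the tree's `μ^loop_D` (`brownianLoopMeasure D`, a measure on
`UnbasedLoop ℂ`) and the transport map `UnbasedLoop.imageOn f D` (`[γ] ↦ [f ∘ γ]` on the loops in
`D`, file `UnbasedLoopImage`):

* `measure_image_eq_of_map_eq` — outer-measure transport: if `ν = F_* μ`, `μ` lives on a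
  measurable set `s`, `F` maps `s` into a measurable `s'` and has a measurable left inverse on `s`,
  then `ν (F '' A) = μ A` for EVERY `A ⊆ s` (measurable hulls; no measurability of `A`);
* `image_hit_inter_hit_inter_inside` — for a bi-continuous equivalence `f : D → D'` (inverse
  `g`) and `K₁, K₂ ⊆ D`, the loops in `D'` meeting `f(K₁)` and `f(K₂)` are exactly the images of
  the loops in `D` meeting `K₁` and `K₂`;
* `loopMass_image_eq_of_map_eq` (bi-continuous `f`) and
  `loopMass_image_eq_of_map_brownianLoopMeasure_eq` (`f : ConformalEquiv D D'`) — **if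
  `(μ^loop_D).map (imageOn f D) = μ^loop_{D'}` then `Λ(f(K₁), f(K₂); D') = Λ(K₁, K₂; D)` for all
  `K₁, K₂ ⊆ D`** (arbitrary sets: `Λ` is an outer measure).

* `loopMass_conformalImage_of_map_brownianLoopMeasure_eq` — hence the named fact
  `loopMass_conformalImage` follows from [LW04] Prop. 6 for `brownianLoopMeasure`.

What is NOT here: [LW04] Prop. 6 itself (conformal invariance of planar Brownian motion up to
time change, the bridge decomposition and the re-rooting argument of [LW04] §4.1 / [Lawler 2005]
Prop. 5.27; the re-rooting invariance is `BrownianLoopRerooting`).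

## References

* G. F. Lawler, *Partition functions, loop measure, and versions of SLE*, J. Stat. Phys. 134
  (2009) 813–837, §2.2.
* G. F. Lawler, W. Werner, *The Brownian loop soup*, PTRF 128 (2004) 565–588, §4.1, Prop. 6.
-/

noncomputable section

open Set MeasureTheory
open scoped ENNReal

namespace Literature.Probability.RandomPlanarGeometry

/-! ### Outer-measure transport along a map with a measurable partial inverse -/

/-- **Transport of outer measure.** Let `ν = F_* μ` with `F` measurable, let `μ` give no mass to
the complement of a measurable set `s`, let `F` map `s` into a measurable set `s'`, and let a
measurable `G` invert `F` on `s`. Then `ν (F '' A) = μ A` for every — not necessarily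
measurable — `A ⊆ s`: `≥` is `Measure.le_map_apply_image`; for `≤`, a measurable hull `T ⊇ A`
gives the measurable set `s' ∩ G ⁻¹' (T ∩ s) ⊇ F '' A` of `ν`-measure `≤ μ T = μ A`. [folklore] -/
theorem measure_image_eq_of_map_eq {X : Type*} [MeasurableSpace X] {μ ν : Measure X}
    {F G : X → X} {s s' : Set X} (hF : Measurable F) (hG : Measurable G) (hs : MeasurableSet s)
    (hs' : MeasurableSet s') (hμ : μ sᶜ = 0) (hmaps : MapsTo F s s') (hGF : LeftInvOn G F s)
    (hmap : μ.map F = ν) {A : Set X} (hA : A ⊆ s) : ν (F '' A) = μ A := by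
  refine le_antisymm ?_ (hmap ▸ Measure.le_map_apply_image hF.aemeasurable A)
  set T := toMeasurable μ A with hT
  set W := s' ∩ G ⁻¹' (T ∩ s) with hW
  have hWm : MeasurableSet W := hs'.inter (hG (((measurableSet_toMeasurable μ A)).inter hs))
  have hAW : F '' A ⊆ W := by
    rintro _ ⟨x, hx, rfl⟩
    exact ⟨hmaps (hA hx), show G (F x) ∈ T ∩ s by
      rw [hGF (hA hx)]; exact ⟨subset_toMeasurable μ A hx, hA hx⟩⟩
  have hpre : F ⁻¹' W ∩ s ⊆ T := by
    rintro x ⟨hxW, hxs⟩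
    have h : G (F x) ∈ T := hxW.2.1
    rwa [hGF hxs] at h
  calc ν (F '' A) ≤ ν W := measure_mono hAW
    _ = μ (F ⁻¹' W) := by rw [← hmap, Measure.map_apply hF hWm]
    _ ≤ μ (F ⁻¹' W ∩ s) + μ (F ⁻¹' W \ s) := measure_le_inter_add_sdiff _ _ _
    _ ≤ μ T + μ sᶜ := add_le_add (measure_mono hpre) (measure_mono fun x hx ↦ hx.2)
    _ = μ A := by rw [hμ, add_zero, hT, measure_toMeasurable]

open UnbasedLoop

/-! ### Transport of the events and of `Λ` along a bi-continuous equivalence `D → D'` -/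

variable {D D' : Set ℂ}

/-- **The loops in `D'` meeting `f(K₁)` and `f(K₂)` are the images of the loops in `D` meeting
`K₁` and `K₂`**, for maps `f : D → D'`, `g : D' → D` continuous on `D`, `D'` and inverse to each
other, and `K₁, K₂ ⊆ D` ([Lawler2009] §2.2, for conformal `f`). [cite: Lawler2009, §2.2] -/
theorem image_hit_inter_hit_inter_inside {f g : ℂ → ℂ} (hf : ContinuousOn f D)
    (hg : ContinuousOn g D') (hfD : MapsTo f D D') (hgD : MapsTo g D' D) (hgf : LeftInvOn g f D)
    (hfg : LeftInvOn f g D') {K₁ K₂ : Set ℂ} (h₁ : K₁ ⊆ D) (h₂ : K₂ ⊆ D) :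
    imageOn f D '' (hit K₁ ∩ hit K₂ ∩ inside D) =
      hit (f '' K₁) ∩ hit (f '' K₂) ∩ inside D' := by
  have hinj : InjOn f D := hgf.injOn
  ext y
  constructor
  · rintro ⟨x, ⟨⟨hx₁, hx₂⟩, hxD⟩, rfl⟩
    exact ⟨⟨(imageOn_mem_hit_image_iff hf hinj h₁ hxD).2 hx₁,
      (imageOn_mem_hit_image_iff hf hinj h₂ hxD).2 hx₂⟩, mapsTo_imageOn hf hfD hxD⟩
  · rintro ⟨⟨hy₁, hy₂⟩, hyD'⟩
    have hxD : imageOn g D' y ∈ inside D := mapsTo_imageOn hg hgD hyD'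
    have hxy : imageOn f D (imageOn g D' y) = y := imageOn_imageOn hg hf hgD hfg hyD'
    refine ⟨imageOn g D' y, ⟨⟨?_, ?_⟩, hxD⟩, hxy⟩
    · exact (imageOn_mem_hit_image_iff hf hinj h₁ hxD).1 (by rw [hxy]; exact hy₁)
    · exact (imageOn_mem_hit_image_iff hf hinj h₂ hxD).1 (by rw [hxy]; exact hy₂)

/-- For open `D`, `μ^loop_D` sees only the part of an event inside `D`. [folklore] -/
theorem brownianLoopMeasure_inter_inside (hD : IsOpen D) (S : Set (UnbasedLoop ℂ)) :
    brownianLoopMeasure D (S ∩ inside D) = brownianLoopMeasure D S := by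
  have hm := measurableSet_inside_of_isOpen hD
  rw [brownianLoopMeasure_apply' hm, brownianLoopMeasure_apply' hm, inter_assoc, inter_self]

/-- **`Λ` is transported along any bi-continuous equivalence under which `μ^loop` is**: for open
`D, D'`, maps `f : D → D'`, `g : D' → D` continuous and inverse to each other, such that
`μ^loop_D` pushes forward to `μ^loop_{D'}` along `[γ] ↦ [f ∘ γ]`, and arbitrary `K₁, K₂ ⊆ D`,
`Λ(f(K₁), f(K₂); D') = Λ(K₁, K₂; D)` (outer measures: measurable hulls are transported,
`measure_image_eq_of_map_eq`). The form of [Lawler2009] §2.2's deduction used for conformal and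
for affine `f`. [cite: Lawler2009, §2.2] -/
theorem loopMass_image_eq_of_map_eq {f g : ℂ → ℂ} (hD : IsOpen D) (hD' : IsOpen D')
    (hf : ContinuousOn f D) (hg : ContinuousOn g D') (hfD : MapsTo f D D') (hgD : MapsTo g D' D)
    (hgf : LeftInvOn g f D) (hfg : LeftInvOn f g D')
    (h : (brownianLoopMeasure D).map (imageOn f D) = brownianLoopMeasure D') {K₁ K₂ : Set ℂ}
    (h₁ : K₁ ⊆ D) (h₂ : K₂ ⊆ D) : loopMass D' (f '' K₁) (f '' K₂) = loopMass D K₁ K₂ := by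
  rw [loopMass_def, loopMass_def, ← brownianLoopMeasure_inter_inside hD',
    ← brownianLoopMeasure_inter_inside hD,
    ← image_hit_inter_hit_inter_inside hf hg hfD hgD hgf hfg h₁ h₂]
  exact measure_image_eq_of_map_eq (measurable_imageOn hD) (measurable_imageOn hD')
    (measurableSet_inside_of_isOpen hD) (measurableSet_inside_of_isOpen hD')
    (brownianLoopMeasure_compl_inside hD) (mapsTo_imageOn hf hfD)
    (fun u hu ↦ imageOn_imageOn hf hg hfD hgf hu) h inter_subset_right

/-- **Conformal invariance of `Λ` from conformal invariance of the loop measure** ([Lawler2009]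
§2.2: "if `f : D → f(D)` is a conformal transformation, then
`Λ(f(K₁), f(K₂); f(D)) = Λ(K₁, K₂; D)`", as a consequence of "the image of the loop measure on
`D` under `f` is the same as the loop measure in `f(D)`", [LW04] Prop. 6). For open `D, D'`, a
conformal equivalence `f : D → D'` under which `μ^loop_D` pushes forward to `μ^loop_{D'}` along
`[γ] ↦ [f ∘ γ]`, and arbitrary `K₁, K₂ ⊆ D`. [cite: Lawler2009, §2.2] -/
theorem loopMass_image_eq_of_map_brownianLoopMeasure_eq (hD : IsOpen D) (hD' : IsOpen D')
    (f : ConformalEquiv D D')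
    (h : (brownianLoopMeasure D).map (imageOn f D) = brownianLoopMeasure D') {K₁ K₂ : Set ℂ}
    (h₁ : K₁ ⊆ D) (h₂ : K₂ ⊆ D) : loopMass D' (f '' K₁) (f '' K₂) = loopMass D K₁ K₂ :=
  loopMass_image_eq_of_map_eq hD hD' f.continuousOn f.symm.continuousOn f.mapsTo f.symm_mapsTo
    (fun _ hx ↦ f.symm_apply_apply hx) (fun _ hy ↦ f.apply_symm_apply hy) h h₁ h₂

/-- **`loopMass_conformalImage` follows from the conformal invariance of `μ^loop_D` as a
measure** ([LW04] Prop. 6: "`f ∘ μ^loop_D = μ^loop_{D'}`", in the tree's terms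
`(μ^loop_D).map (imageOn f D) = μ^loop_{D'}` for open `D, D'` and conformal equivalences
`f : D → D'`) — the deduction of [Lawler2009] §2.2, leaving Prop. 6 itself (conformal
invariance of planar Brownian motion up to time change, bridge decomposition, re-rooting) as
the hypothesis. [cite: Lawler2009, §2.2] -/
theorem loopMass_conformalImage_of_map_brownianLoopMeasure_eq
    (h : ∀ {D D' : Set ℂ}, IsOpen D → IsOpen D' → ∀ f : ConformalEquiv D D',
      (brownianLoopMeasure D).map (imageOn f D) = brownianLoopMeasure D') :
    loopMass_conformalImage := by
  unfold loopMass_conformalImage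
  intro D D' hD _ hD' f K₁ K₂ h₁ h₂
  exact loopMass_image_eq_of_map_brownianLoopMeasure_eq hD hD' f (h hD hD' f) h₁ h₂

end Literature.Probability.RandomPlanarGeometry

end
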